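import Mathlib
import Summits.PneNP.PneNP.Theorems.CnfIdealGenLengthRankDefectRepresentationsMergeLowerBound

/-!
# Crux `RankDefectRepresentations` (stmt-PneNP-18923), line `cell-union-merge`: the polynomial bookkeeping,
# part 1 — tools and the level invariant (helper file for the registered stub `stub_polyOfAbsoluteMerge`, brief §B3)

The bookkeeping `AbsoluteMerge lam → JointCutLemma κ → PolyStableIdem` (memo §3.T3) is organised WITHOUT
recursive definitions, as an invariant of FAMILIES of blocks.  A block is a map `E : G → K^{d×d}` (generators
indexed by `G`); a level provides a cell type `X`, a union map `A : G → Finset X` and constants `C, U`, and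
asserts: for every family `E : M → G → K^{d×d}` (ANY index type `M`) of idempotents all of whose pairwise
commutators (inside and across blocks) have rank `≤ t`, there are complete orthogonal systems
`P m : X → K^{d×d}` with (cost) `rank (E m g − Σ_{x ∈ A g} P m x) ≤ C·t` and (cross)
`rank [P m_S, P m'_T] ≤ U·t` for ALL blocks `m, m'` and ALL unions `S, T` (the "pairwise-blocks" invariant of
the brief).  This file: rank tools; unions of one exact system multiply by intersection; the product of two
commuting exact systems is exact and its cylinders are the old unions; the level statement for level `0`
(`G = Unit`, cells `{E, 1 − E}`, `C = 0`, `U = 1`: `level_zero`) and its transport along an injection of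
generator types with monotonicity in the constants (`level_transport`, padding by zero idempotents).
Part 2 (`…PolyOfAbsoluteMerge`) does the merge step, the iteration and the assembly.
HONEST FRAMING: elementary linear algebra in the negative lane; P ≠ NP is not moved; F-N2 is a FRONTIER formal
rung.
-/

set_option linter.dupNamespace false -- `Summit.PneNP.PneNP.…`: summit = sub-problem name (D-0017)

namespace Summit.PneNP.PneNP.Theorems.CnfIdealGenLengthRankDefectRepresentationsPolyOfAbsoluteMergeLevels

open Matrix
open Summit.PneNP.PneNP.Theorems.CnfIdealGenLengthRankDefectRepresentationsMergeLowerBound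
  (rank_add_le' rank_neg' rank_sub_le')

variable {K : Type} [Field K] {d : ℕ}

/-! ## Rank tools -/

/-- Commutator ranks are symmetric: `rank [A, B] = rank [B, A]`. -/
theorem rank_comm_symm (A B : Matrix (Fin d) (Fin d) K) :
    (A * B - B * A).rank = (B * A - A * B).rank := by
  rw [← neg_sub (B * A) (A * B), rank_neg']

/-- Triangle inequality for ranks of differences. -/
theorem rank_sub_triangle (A B C : Matrix (Fin d) (Fin d) K) :
    (A - C).rank ≤ (A - B).rank + (B - C).rank := by
  rw [← sub_add_sub_cancel A B C]
  exact rank_add_le' _ _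

/-- Perturbing one argument of a commutator: `rank [X', G] ≤ rank [X, G] + 2·rank (X − X')`. -/
theorem rank_comm_perturb (X X' G : Matrix (Fin d) (Fin d) K) :
    (X' * G - G * X').rank ≤ (X * G - G * X).rank + ((X - X').rank + (X - X').rank) := by
  have h : X' * G - G * X' = (X * G - G * X) - ((X - X') * G - G * (X - X')) := by
    simp only [Matrix.sub_mul, Matrix.mul_sub]
    abel
  rw [h]
  refine (rank_sub_le' _ _).trans (Nat.add_le_add_left ?_ _)
  exact (rank_sub_le' _ _).trans
    (Nat.add_le_add (Matrix.rank_mul_le_left _ _) (Matrix.rank_mul_le_right _ _))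

/-- The rank of a scalar multiple is at most the rank. -/
theorem rank_smul_le (c : K) (A : Matrix (Fin d) (Fin d) K) : (c • A).rank ≤ A.rank := by
  rw [Matrix.smul_eq_diagonal_mul]
  exact Matrix.rank_mul_le_right _ _

/-- Commutator of an affine combination `α·1 + β·E` with `G` is `β·[E, G]`. -/
theorem comm_affine (α β : K) (E G : Matrix (Fin d) (Fin d) K) :
    (α • (1 : Matrix (Fin d) (Fin d) K) + β • E) * G - G * (α • (1 : Matrix (Fin d) (Fin d) K) + β • E) =
      β • (E * G - G * E) := by
  rw [Matrix.add_mul, Matrix.mul_add, Matrix.smul_mul, Matrix.smul_mul, Matrix.mul_smul, Matrix.mul_smul,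
    Matrix.one_mul, Matrix.mul_one, smul_sub]
  abel

/-! ## Complete orthogonal systems: unions multiply by intersection; products of commuting systems -/

/-- In a system of orthogonal idempotents, unions multiply by intersection: `P_S * P_T = P_{S ∩ T}`. -/
theorem cells_sum_mul_sum {X : Type} [DecidableEq X] (P : X → Matrix (Fin d) (Fin d) K)
    (hid : ∀ x, P x * P x = P x) (hor : ∀ x x', x ≠ x' → P x * P x' = 0) (S T : Finset X) :
    (∑ x ∈ S, P x) * (∑ x ∈ T, P x) = ∑ x ∈ S ∩ T, P x := by
  rw [Finset.sum_mul_sum, ← Finset.sum_ite_mem]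
  refine Finset.sum_congr rfl fun x _ => ?_
  have h : ∀ x', P x * P x' = if x = x' then P x' else 0 := by
    intro x'
    by_cases hx : x = x'
    · subst hx
      rw [if_pos rfl, hid]
    · rw [if_neg hx, hor x x' hx]
  simp_rw [h]
  exact Finset.sum_ite_eq T x P

section Prod

variable {X Y : Type}

/-- Products of two commuting systems of idempotents are idempotent. -/
theorem prod_cells_idem (P : X → Matrix (Fin d) (Fin d) K) (Q : Y → Matrix (Fin d) (Fin d) K)
    (hP : ∀ x, P x * P x = P x) (hQ : ∀ y, Q y * Q y = Q y) (hc : ∀ x y, P x * Q y = Q y * P x)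
    (p : X × Y) : P p.1 * Q p.2 * (P p.1 * Q p.2) = P p.1 * Q p.2 := by
  calc P p.1 * Q p.2 * (P p.1 * Q p.2) = P p.1 * (Q p.2 * P p.1) * Q p.2 := by
        simp only [Matrix.mul_assoc]
    _ = P p.1 * (P p.1 * Q p.2) * Q p.2 := by rw [← hc]
    _ = (P p.1 * P p.1) * (Q p.2 * Q p.2) := by simp only [Matrix.mul_assoc]
    _ = P p.1 * Q p.2 := by rw [hP, hQ]

/-- Products of two commuting orthogonal systems are orthogonal. -/
theorem prod_cells_orth (P : X → Matrix (Fin d) (Fin d) K) (Q : Y → Matrix (Fin d) (Fin d) K)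
    (hPo : ∀ x x', x ≠ x' → P x * P x' = 0) (hQo : ∀ y y', y ≠ y' → Q y * Q y' = 0)
    (hc : ∀ x y, P x * Q y = Q y * P x) (p q : X × Y) (hpq : p ≠ q) :
    P p.1 * Q p.2 * (P q.1 * Q q.2) = 0 := by
  have h : P p.1 * Q p.2 * (P q.1 * Q q.2) = (P p.1 * P q.1) * (Q p.2 * Q q.2) := by
    calc P p.1 * Q p.2 * (P q.1 * Q q.2) = P p.1 * (Q p.2 * P q.1) * Q q.2 := by
          simp only [Matrix.mul_assoc]
      _ = P p.1 * (P q.1 * Q p.2) * Q q.2 := by rw [← hc]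
      _ = (P p.1 * P q.1) * (Q p.2 * Q q.2) := by simp only [Matrix.mul_assoc]
  rw [h]
  by_cases h1 : p.1 = q.1
  · have h2 : p.2 ≠ q.2 := fun h2 => hpq (Prod.ext h1 h2)
    rw [hQo _ _ h2, Matrix.mul_zero]
  · rw [hPo _ _ h1, Matrix.zero_mul]

/-- Products of two complete systems are complete. -/
theorem prod_cells_sum [Fintype X] [Fintype Y] (P : X → Matrix (Fin d) (Fin d) K)
    (Q : Y → Matrix (Fin d) (Fin d) K)
    (hP : ∑ x, P x = 1) (hQ : ∑ y, Q y = 1) : ∑ p : X × Y, P p.1 * Q p.2 = 1 := by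
  rw [Fintype.sum_prod_type]
  simp only [← Finset.mul_sum, hQ, Matrix.mul_one, hP]

/-- A left cylinder `S × Y` of the product system is the old union `P_S` (when `Q` is complete). -/
theorem prod_cells_sum_fst [Fintype Y] (P : X → Matrix (Fin d) (Fin d) K)
    (Q : Y → Matrix (Fin d) (Fin d) K) (hQ : ∑ y, Q y = 1) (S : Finset X) :
    ∑ p ∈ S ×ˢ (Finset.univ : Finset Y), P p.1 * Q p.2 = ∑ x ∈ S, P x := by
  rw [Finset.sum_product]
  simp only [← Finset.mul_sum, hQ, Matrix.mul_one]

/-- A right cylinder `X × T` of the product system is the old union `Q_T` (when `P` is complete). -/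
theorem prod_cells_sum_snd [Fintype X] (P : X → Matrix (Fin d) (Fin d) K)
    (Q : Y → Matrix (Fin d) (Fin d) K) (hP : ∑ x, P x = 1) (T : Finset Y) :
    ∑ p ∈ (Finset.univ : Finset X) ×ˢ T, P p.1 * Q p.2 = ∑ y ∈ T, Q y := by
  rw [Finset.sum_product, Finset.sum_comm]
  simp only [← Finset.sum_mul, hP, Matrix.one_mul]

end Prod

/-! ## The two-cell system `{E, 1 − E}` (level 0) -/

/-- A sum over a subset of `Bool`. -/
theorem sum_finset_bool (f : Bool → Matrix (Fin d) (Fin d) K) (S : Finset Bool) :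
    ∑ x ∈ S, f x = (if true ∈ S then f true else 0) + (if false ∈ S then f false else 0) := by
  have h : S = Finset.univ.filter (fun x => x ∈ S) := by
    ext b
    simp
  calc ∑ x ∈ S, f x = ∑ x ∈ Finset.univ.filter (fun x => x ∈ S), f x := by rw [← h]
    _ = ∑ x : Bool, if x ∈ S then f x else 0 := Finset.sum_filter _ _
    _ = _ := Fintype.sum_bool _

/-- Every union of cells of `{E, 1 − E}` is `0`, `E`, `1 − E` or `1`: an affine combination `α·1 + β·E`. -/
theorem bool_cells_affine (E : Matrix (Fin d) (Fin d) K) (S : Finset Bool) :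
    ∃ α β : K, ∑ x ∈ S, (bif x then E else 1 - E) =
      α • (1 : Matrix (Fin d) (Fin d) K) + β • E := by
  rw [sum_finset_bool]
  simp only [cond_true, cond_false]
  by_cases ht : true ∈ S <;> by_cases hf : false ∈ S <;> simp only [ht, hf, if_true, if_false]
  · exact ⟨1, 0, by simp⟩
  · exact ⟨0, 1, by simp⟩
  · exact ⟨1, -1, by simp [sub_eq_add_neg]⟩
  · exact ⟨0, 0, by simp⟩

/-! ## The level invariant

For a generator type `G`, a cell type `X`, a union map `A : G → Finset X` and constants `C U t`, the LEVEL
STATEMENT is: every family `E : M → G → K^{d×d}` of idempotents with all pairwise commutator ranks `≤ t` admits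
complete orthogonal systems `P m : X → K^{d×d}` with `rank (E m g − Σ_{x ∈ A g} P m x) ≤ C t` and
`rank [P m_S, P m'_T] ≤ U t` for all `m m' S T`.  It is written out verbatim in each of the four lemmas below
(transport, level zero, successor, iteration). -/

/-- **Transport / padding / monotonicity.**  The level statement pulls back along an injection of generator types
`f : G' → G` (extend a `G'`-block by the zero idempotent) and is monotone in the constants. -/
theorem level_transport {G G' X : Type} [Fintype X] (A : G → Finset X) (f : G' → G)
    (hf : Function.Injective f) {t C U C' U' : ℕ} (hC : C ≤ C') (hU : U ≤ U')
    (h : ∀ (M : Type) (E : M → G → Matrix (Fin d) (Fin d) K),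
      (∀ m g, E m g * E m g = E m g) →
      (∀ m m' g g', (E m g * E m' g' - E m' g' * E m g).rank ≤ t) →
      ∃ P : M → X → Matrix (Fin d) (Fin d) K,
        (∀ m x, P m x * P m x = P m x) ∧
        (∀ m x x', x ≠ x' → P m x * P m x' = 0) ∧
        (∀ m, ∑ x, P m x = 1) ∧
        (∀ m g, (E m g - ∑ x ∈ A g, P m x).rank ≤ C * t) ∧
        (∀ m m' (S T : Finset X),
          ((∑ x ∈ S, P m x) * (∑ x ∈ T, P m' x) - (∑ x ∈ T, P m' x) * (∑ x ∈ S, P m x)).rank ≤ U * t)) :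
    ∀ (M : Type) (E : M → G' → Matrix (Fin d) (Fin d) K),
      (∀ m g, E m g * E m g = E m g) →
      (∀ m m' g g', (E m g * E m' g' - E m' g' * E m g).rank ≤ t) →
      ∃ P : M → X → Matrix (Fin d) (Fin d) K,
        (∀ m x, P m x * P m x = P m x) ∧
        (∀ m x x', x ≠ x' → P m x * P m x' = 0) ∧
        (∀ m, ∑ x, P m x = 1) ∧
        (∀ m g, (E m g - ∑ x ∈ A (f g), P m x).rank ≤ C' * t) ∧
        (∀ m m' (S T : Finset X),
          ((∑ x ∈ S, P m x) * (∑ x ∈ T, P m' x) - (∑ x ∈ T, P m' x) * (∑ x ∈ S, P m x)).rank ≤ U' * t) := by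
  intro M E' hE' hc'
  classical
  -- pad: extend each block by the zero idempotent outside the range of `f`
  let E : M → G → Matrix (Fin d) (Fin d) K := fun m => Function.extend f (E' m) 0
  have hEf : ∀ m g', E m (f g') = E' m g' := fun m g' => hf.extend_apply _ _ _
  have hEn : ∀ m g, (¬ ∃ g', f g' = g) → E m g = 0 := fun m g hg => by
    simp only [E, Function.extend_apply' _ _ _ hg, Pi.zero_apply]
  have hE : ∀ m g, E m g * E m g = E m g := by
    intro m g
    by_cases hg : ∃ g', f g' = g
    · obtain ⟨g', rfl⟩ := hg
      rw [hEf]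
      exact hE' m g'
    · rw [hEn m g hg, Matrix.mul_zero]
  have hc : ∀ m m' g g', (E m g * E m' g' - E m' g' * E m g).rank ≤ t := by
    intro m m' g g'
    by_cases hg : ∃ a, f a = g
    · obtain ⟨a, rfl⟩ := hg
      by_cases hg' : ∃ a', f a' = g'
      · obtain ⟨a', rfl⟩ := hg'
        rw [hEf, hEf]
        exact hc' m m' a a'
      · rw [hEn m' g' hg']
        simp
    · rw [hEn m g hg]
      simp
  obtain ⟨P, h1, h2, h3, h4, h5⟩ := h M E hE hc
  refine ⟨P, h1, h2, h3, fun m g' => ?_,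
    fun m m' S T => (h5 m m' S T).trans (Nat.mul_le_mul_right _ hU)⟩
  have h4' := h4 m (f g')
  rw [hEf] at h4'
  exact h4'.trans (Nat.mul_le_mul_right _ hC)

/-- **Level zero**: one generator per block (`G = Unit`), the two-cell system `{E, 1 − E}` indexed by `Bool`
(`true ↦ E`), the generator is the union over `{true}`; cost `0`, cross constant `1` (every union is
`α·1 + β·E`, so cross commutators are multiples of `[E_m, E_{m'}]`). -/
theorem level_zero (t : ℕ) :
    ∀ (M : Type) (E : M → Unit → Matrix (Fin d) (Fin d) K),
      (∀ m g, E m g * E m g = E m g) →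
      (∀ m m' g g', (E m g * E m' g' - E m' g' * E m g).rank ≤ t) →
      ∃ P : M → Bool → Matrix (Fin d) (Fin d) K,
        (∀ m x, P m x * P m x = P m x) ∧
        (∀ m x x', x ≠ x' → P m x * P m x' = 0) ∧
        (∀ m, ∑ x, P m x = 1) ∧
        (∀ m g, (E m g - ∑ x ∈ (fun _ : Unit => ({true} : Finset Bool)) g, P m x).rank ≤ 0 * t) ∧
        (∀ m m' (S T : Finset Bool),
          ((∑ x ∈ S, P m x) * (∑ x ∈ T, P m' x) - (∑ x ∈ T, P m' x) * (∑ x ∈ S, P m x)).rank ≤ 1 * t) := by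
  intro M E hE hc
  refine ⟨fun m b => bif b then E m () else 1 - E m (), ?_, ?_, ?_, ?_, ?_⟩
  · intro m b
    cases b
    · show (1 - E m ()) * (1 - E m ()) = 1 - E m ()
      simp only [Matrix.sub_mul, Matrix.mul_sub, Matrix.one_mul, Matrix.mul_one, hE, sub_self, sub_zero]
    · exact hE m ()
  · intro m b b' hbb'
    cases b <;> cases b'
    · exact absurd rfl hbb'
    · show (1 - E m ()) * E m () = 0
      rw [Matrix.sub_mul, Matrix.one_mul, hE, sub_self]
    · show E m () * (1 - E m ()) = 0
      rw [Matrix.mul_sub, Matrix.mul_one, hE, sub_self]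
    · exact absurd rfl hbb'
  · intro m
    rw [Fintype.sum_bool]
    show E m () + (1 - E m ()) = 1
    abel
  · intro m g
    rw [Finset.sum_singleton]
    show (E m () - E m ()).rank ≤ 0 * t
    simp
  · intro m m' S T
    dsimp only
    obtain ⟨α, β, hS⟩ := bool_cells_affine (E m ()) S
    obtain ⟨α', β', hT⟩ := bool_cells_affine (E m' ()) T
    rw [hS, hT, comm_affine]
    refine (rank_smul_le _ _).trans ?_
    rw [rank_comm_symm, comm_affine]
    refine (rank_smul_le _ _).trans ?_
    rw [one_mul]
    exact hc m' m () ()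

end Summit.PneNP.PneNP.Theorems.CnfIdealGenLengthRankDefectRepresentationsPolyOfAbsoluteMergeLevels
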